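import Summits.RiemannHypothesis.RiemannHypothesis.Theorems.HandoffDodgerHorizonGlue
import Summits.RiemannHypothesis.RiemannHypothesis.Theorems.HandoffDodgerDeficitIntegral
import Summits.RiemannHypothesis.RiemannHypothesis.Theorems.HandoffDodgerPowerSums
import HarnessLib

/-!
# HANDOFF — the HORIZON CHOICE: eliminating `K = N(T′)`, `∫tD` and `p₁` by explicit bounds (rh-explicit, track «HANDOFF», seat prove-2 gen10, ATTEMPT-19 §8 (P2)–(P4))

HONEST FRAMING. Nothing here bears on the truth of RH; this is zero COUNTING (the tree's two-sided Hasanalizade–Shen–Wong bound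
`zetaZeroCount_hasanalizade_shen_wong_holds`) and elementary algebra. It is the first half of the parameter discharge (R-4) of the
dodger wall ceiling: at killing height `T′ = πk′/b` (a lattice point, `k′` with `T* − π/b ≤ T′ ≤ T* ≤ T₀ − 4π(s+2)`, `T₀ = 2πe^{1+2b}`,
`s = s₁(T₀)`, `s₁(t) = 0.1038 log t + 0.2573 log log t + 9.3675`), the three NON-EXPLICIT quantities of `HandoffDodgerWitness.dodger_witness` —
the killed count `K = N(T′)`, the deficit integral `∫₀^{T′} t·D(t)dt` of the clean-horizon taper `D`, and the first power sum `p₁ = Re S_1` —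
are sandwiched by EXPLICIT functions of `(b, k′)`:
(1) `horizon_package`: the clean horizon with `s = s₁(T₀)` (`HandoffDodgerHorizonGlue` ⊕ HSW): `πK/b ≤ T′`, the taper `D ≥ 0` continuous,
`N − Λ_K ≤ −D` on `[0, T′]`; (2) `zetaZeroCount_horizon_le` / `_ge`: **`k′ − 3s − 5 ≤ K ≤ k′`** (upper: the clean horizon; lower: HSW at `T′`
and `log(T₀/T′) ≤ (T₀ − T′)/T′`); (3) `deficitIntegral_ge`: **`∫₀^{T′} tD ≥ (ℓ₋ − 1)³/(18π) − (log T₀ + ⅓)/(6π) − (s+1)(T′−1)²/2`**, `ℓ₋ = T′ − π(3s+5)/b`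
(`integral_mul_taper_ge` at `ℓ = πK/b ∈ [ℓ₋, T′]`); (4) `re_dodgerPowerSum_one_bounds`: **`2·(that) − k′/4 ≤ p₁ ≤ k′(T′²+¼)`**.
No `sorry`, standard axioms, no definitions.

References: this track (ATTEMPT-16 §3 Lemma B1/B2, §6.1; ATTEMPT-19 §8).
-/

set_option linter.dupNamespace false

noncomputable section

open Real Set MeasureTheory intervalIntegral

namespace Summit.RiemannHypothesis.RiemannHypothesis.Theorems.Handoff

open Literature.NumberTheory.LFunctions Literature.NumberTheory.LFunctions.SchoenfeldBound


/-! ## Elementary facts about `T₀ = 2πe^{1+2b}` and `s₁` -/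

/-- `e ≤ T₀`, `1 ≤ log T₀`, `0 ≤ log log T₀`, `1 ≤ (0.1038 * Real.log (T₀) + 0.2573 * Real.log (Real.log (T₀)) + 9.3675)` for `b ≥ 1`. [this track, ATTEMPT-16 §1] -/
theorem horizonT₀_facts {b T₀ : ℝ} (hb : 1 ≤ b) (hT₀ : T₀ = 2 * π * Real.exp (1 + 2 * b)) :
    Real.exp 1 ≤ T₀ ∧ 0 < T₀ ∧ 1 ≤ Real.log T₀ ∧ 0 ≤ Real.log (Real.log T₀) ∧ 1 ≤ (0.1038 * Real.log (T₀) + 0.2573 * Real.log (Real.log (T₀)) + 9.3675) ∧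
      Real.log T₀ = Real.log (2 * π) + 1 + 2 * b := by
  have hπ3 : 3 < π := Real.pi_gt_three
  have hexp : Real.exp 1 ≤ Real.exp (1 + 2 * b) := Real.exp_le_exp.2 (by linarith)
  have hT₀e : Real.exp 1 ≤ T₀ := by
    rw [hT₀]; nlinarith [Real.exp_pos (1 + 2 * b), Real.exp_pos 1]
  have hT₀pos : 0 < T₀ := lt_of_lt_of_le (Real.exp_pos 1) hT₀e
  have hlogT₀ : 1 ≤ Real.log T₀ := by rw [Real.le_log_iff_exp_le hT₀pos]; exact hT₀e
  have hllT₀ : 0 ≤ Real.log (Real.log T₀) := Real.log_nonneg hlogT₀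
  refine ⟨hT₀e, hT₀pos, hlogT₀, hllT₀, by nlinarith, ?_⟩
  rw [hT₀, Real.log_mul (by positivity) (Real.exp_pos _).ne', Real.log_exp]
  ring

/-- `s₁` is non-decreasing on `[e, ∞)`. [folklore] -/
theorem hswErr_mono {t T : ℝ} (hte : Real.exp 1 ≤ t) (htT : t ≤ T) : (0.1038 * Real.log (t) + 0.2573 * Real.log (Real.log (t)) + 9.3675) ≤ (0.1038 * Real.log (T) + 0.2573 * Real.log (Real.log (T)) + 9.3675) := by
  have ht0 : 0 < t := lt_of_lt_of_le (Real.exp_pos 1) hte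
  have hlogt : 1 ≤ Real.log t := by rw [Real.le_log_iff_exp_le ht0]; exact hte
  have hlog_le : Real.log t ≤ Real.log T := Real.log_le_log ht0 htT
  have hll_le : Real.log (Real.log t) ≤ Real.log (Real.log T) := Real.log_le_log (by linarith) hlog_le
  nlinarith

/-! ## The clean horizon with the HSW constant -/

/-- **The clean-horizon package at `s = (0.1038 * Real.log (T₀) + 0.2573 * Real.log (Real.log (T₀)) + 9.3675)`** (`HandoffDodgerHorizonGlue.count_sub_latticeCount_le_neg_taper` with the counting
hypothesis discharged by `zetaZeroCount_hasanalizade_shen_wong_holds`). [this track, ATTEMPT-16 Lemma B1; ATTEMPT-18 (D-4)] -/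
theorem horizon_package {b T₀ Tstar : ℝ} {k' : ℕ} (hb : 1 ≤ b) (hT₀ : T₀ = 2 * π * Real.exp (1 + 2 * b))
    (hT1 : Tstar ≤ T₀ - 4 * π * ((0.1038 * Real.log (T₀) + 0.2573 * Real.log (Real.log (T₀)) + 9.3675) + 2)) (hT2 : T₀ ≤ 11 / 10 * Tstar)
    (hQ1b : (0.1038 * Real.log (T₀) + 0.2573 * Real.log (Real.log (T₀)) + 9.3675) + 1 ≤ 14 / (2 * π) * Real.log (T₀ / 14)) (hk'T : π * k' / b ≤ Tstar) :
    π * (zetaZeroCount (π * k' / b)) / b ≤ π * k' / b ∧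
    Continuous (fun t : ℝ => max 0 (T₀ / (2 * π) * negMulLog (t / T₀) - (0.1038 * Real.log (T₀) + 0.2573 * Real.log (Real.log (T₀)) + 9.3675) - 1) *
      max 0 (min 1 (π * (zetaZeroCount (π * k' / b)) / b - t))) ∧
    (∀ t : ℝ, 0 ≤ max 0 (T₀ / (2 * π) * negMulLog (t / T₀) - (0.1038 * Real.log (T₀) + 0.2573 * Real.log (Real.log (T₀)) + 9.3675) - 1) *
      max 0 (min 1 (π * (zetaZeroCount (π * k' / b)) / b - t))) ∧
    ∀ t ∈ Icc 0 (π * k' / b), (zetaZeroCount t : ℝ) - ((min ⌊b * t / π⌋₊ (zetaZeroCount (π * k' / b)) : ℕ) : ℝ) ≤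
      -(max 0 (T₀ / (2 * π) * negMulLog (t / T₀) - (0.1038 * Real.log (T₀) + 0.2573 * Real.log (Real.log (T₀)) + 9.3675) - 1) *
        max 0 (min 1 (π * (zetaZeroCount (π * k' / b)) / b - t))) := by
  obtain ⟨hT₀e, hT₀pos, hlogT₀, hllT₀, hs1, -⟩ := horizonT₀_facts hb hT₀
  refine count_sub_latticeCount_le_neg_taper hb hT₀ hs1 (fun t h14 htT₀ => ?_) hT1 hT2 hQ1b hk'T
  have hte : Real.exp 1 ≤ t := by have := Real.exp_one_lt_d9; linarith
  have hHSW := (abs_le.1 (zetaZeroCount_hasanalizade_shen_wong_holds t hte)).2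
  have hmono := hswErr_mono hte htT₀
  linarith

/-! ## The killed count `K = N(T′)` -/

/-- **Upper bound `K ≤ k′`** (from the clean horizon `πK/b ≤ πk′/b`). [this track, ATTEMPT-16 Lemma B1] -/
theorem zetaZeroCount_horizon_le {b : ℝ} {k' : ℕ} (hb : 0 < b)
    (hKle : π * (zetaZeroCount (π * k' / b)) / b ≤ π * k' / b) :
    (zetaZeroCount (π * k' / b) : ℝ) ≤ k' := by
  have hπ := Real.pi_pos
  have h := mul_le_mul_of_nonneg_right hKle hb.le
  rw [div_mul_cancel₀ _ hb.ne', div_mul_cancel₀ _ hb.ne'] at h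
  exact le_of_mul_le_mul_left h hπ

/-- **Lower bound `K ≥ k′ − 3s − 5`** (HSW at `T′ = πk′/b`; the main term is `bT′/π − (T′/2π)log(T₀/T′)` and `log(T₀/T′) ≤ (T₀−T′)/T′`,
`T₀ − T′ ≤ 4π(s+2) + π/b`). [this track, ATTEMPT-16 Lemma B1 (c); ATTEMPT-19 §8 (P3)] -/
theorem zetaZeroCount_horizon_ge {b T₀ : ℝ} {k' : ℕ} (hb : 1 ≤ b) (hT₀ : T₀ = 2 * π * Real.exp (1 + 2 * b))
    (hT'e : Real.exp 1 ≤ π * k' / b) (hT'T₀ : π * k' / b ≤ T₀)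
    (hgap : T₀ - π * k' / b ≤ 4 * π * ((0.1038 * Real.log (T₀) + 0.2573 * Real.log (Real.log (T₀)) + 9.3675) + 2) + π / b) :
    (k' : ℝ) - 3 * (0.1038 * Real.log (T₀) + 0.2573 * Real.log (Real.log (T₀)) + 9.3675) - 5 ≤ (zetaZeroCount (π * k' / b) : ℝ) := by
  obtain ⟨hT₀e, hT₀pos, hlogT₀, hllT₀, hs1, hlogeq⟩ := horizonT₀_facts hb hT₀
  have hπ := Real.pi_pos
  have hb0 : 0 < b := by linarith
  set T' : ℝ := π * k' / b with hT'
  have hT'0 : 0 < T' := lt_of_lt_of_le (Real.exp_pos 1) hT'e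
  -- HSW lower bound at `T′`
  have hHSW := (abs_le.1 (zetaZeroCount_hasanalizade_shen_wong_holds T' hT'e)).1
  have hmono := hswErr_mono hT'e hT'T₀
  -- the main term: `(T′/2π) log(T′/(2πe)) = bT′/π − (T′/2π) log(T₀/T′)`
  have hmain : T' / (2 * π) * Real.log (T' / (2 * π * Real.exp 1)) =
      b * T' / π - T' / (2 * π) * Real.log (T₀ / T') := by
    rw [Real.log_div hT'0.ne' (by positivity), Real.log_div hT₀pos.ne' hT'0.ne', Real.log_mul (by positivity) (Real.exp_pos 1).ne',
      Real.log_exp, hlogeq]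
    field_simp
    ring
  have hbT : b * T' / π = k' := by rw [hT']; field_simp
  -- `(T′/2π) log(T₀/T′) ≤ (T₀ − T′)/(2π) ≤ 2(s+2) + 1/(2b) ≤ 2s + 5`
  have hlog : Real.log (T₀ / T') ≤ T₀ / T' - 1 := by
    have := Real.log_le_sub_one_of_pos (show 0 < T₀ / T' by positivity)
    linarith
  have hf : T' / (2 * π) * Real.log (T₀ / T') ≤ 2 * (0.1038 * Real.log (T₀) + 0.2573 * Real.log (Real.log (T₀)) + 9.3675) + 5 := by
    have h1 : T' / (2 * π) * Real.log (T₀ / T') ≤ T' / (2 * π) * (T₀ / T' - 1) :=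
      mul_le_mul_of_nonneg_left hlog (by positivity)
    have h2 : T' / (2 * π) * (T₀ / T' - 1) = (T₀ - T') / (2 * π) := by field_simp
    have h3 : (T₀ - T') / (2 * π) ≤ (4 * π * ((0.1038 * Real.log (T₀) + 0.2573 * Real.log (Real.log (T₀)) + 9.3675) + 2) + π / b) / (2 * π) := div_le_div_of_nonneg_right hgap (by positivity)
    have h4 : (4 * π * ((0.1038 * Real.log (T₀) + 0.2573 * Real.log (Real.log (T₀)) + 9.3675) + 2) + π / b) / (2 * π) = 2 * ((0.1038 * Real.log (T₀) + 0.2573 * Real.log (Real.log (T₀)) + 9.3675) + 2) + 1 / (2 * b) := by field_simp; ring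
    have h5 : 1 / (2 * b) ≤ 1 := by rw [div_le_one (by positivity)]; linarith
    linarith
  rw [hmain, hbT] at hHSW
  linarith

/-! ## The deficit integral and the first power sum -/

/-- **The deficit integral from below**: with `K = N(T′)` in `[k′ − 3s − 5, k′]` and `πK/b ≤ T′`,
`∫₀^{T′} t·D(t)dt ≥ (ℓ₋ − 1)³/(18π) − (log T₀ + ⅓)/(6π) − (s+1)(T′ − 1)²/2`, `ℓ₋ := T′ − π(3s+5)/b` (`2 ≤ ℓ₋`).
[this track, ATTEMPT-16 Lemma B2; ATTEMPT-18 (D-4); ATTEMPT-19 §8 (P3)] -/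
theorem deficitIntegral_ge {b T₀ : ℝ} {k' : ℕ} (hb : 1 ≤ b) (hT₀ : T₀ = 2 * π * Real.exp (1 + 2 * b))
    (hKle : π * (zetaZeroCount (π * k' / b)) / b ≤ π * k' / b)
    (hKge : (k' : ℝ) - 3 * (0.1038 * Real.log (T₀) + 0.2573 * Real.log (Real.log (T₀)) + 9.3675) - 5 ≤ (zetaZeroCount (π * k' / b) : ℝ))
    (hℓ2 : 2 ≤ π * k' / b - π * (3 * (0.1038 * Real.log (T₀) + 0.2573 * Real.log (Real.log (T₀)) + 9.3675) + 5) / b) (hT'T₀ : π * k' / b ≤ T₀) :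
    (π * k' / b - π * (3 * (0.1038 * Real.log (T₀) + 0.2573 * Real.log (Real.log (T₀)) + 9.3675) + 5) / b - 1) ^ 3 / (18 * π) - (Real.log T₀ + 1 / 3) / (6 * π) -
        ((0.1038 * Real.log (T₀) + 0.2573 * Real.log (Real.log (T₀)) + 9.3675) + 1) * (π * k' / b - 1) ^ 2 / 2 ≤
      ∫ t in (0 : ℝ)..(π * k' / b), t * (max 0 (T₀ / (2 * π) * negMulLog (t / T₀) - (0.1038 * Real.log (T₀) + 0.2573 * Real.log (Real.log (T₀)) + 9.3675) - 1) *
        max 0 (min 1 (π * (zetaZeroCount (π * k' / b)) / b - t))) := by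
  obtain ⟨hT₀e, hT₀pos, hlogT₀, hllT₀, hs1, -⟩ := horizonT₀_facts hb hT₀
  have hπ := Real.pi_pos
  have hb0 : 0 < b := by linarith
  set T' : ℝ := π * k' / b with hT'
  set ℓ : ℝ := π * (zetaZeroCount T') / b with hℓ
  set s : ℝ := (0.1038 * Real.log (T₀) + 0.2573 * Real.log (Real.log (T₀)) + 9.3675) with hs
  -- `ℓ₋ ≤ ℓ ≤ T′`
  have hℓlow : T' - π * (3 * s + 5) / b ≤ ℓ := by
    have h := mul_le_mul_of_nonneg_left hKge (show 0 ≤ π / b by positivity)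
    have e1 : π / b * ((k' : ℝ) - 3 * s - 5) = T' - π * (3 * s + 5) / b := by rw [hT']; field_simp; ring
    have e2 : π / b * (zetaZeroCount T' : ℝ) = ℓ := by rw [hℓ]; field_simp
    rw [e1, e2] at h
    exact h
  have hℓT : ℓ ≤ T' := hKle
  have h := integral_mul_taper_ge (T₀ := T₀) (s := s) (ℓ := ℓ) (T' := T') hT₀pos (by linarith) (by linarith) (by linarith) hℓT
  refine le_trans ?_ h
  have h1 : (T' - π * (3 * s + 5) / b - 1) ^ 3 ≤ (ℓ - 1) ^ 3 :=
    pow_le_pow_left₀ (by linarith) (by linarith) 3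
  have h2 : (s + 1) * (ℓ - 1) ^ 2 ≤ (s + 1) * (T' - 1) ^ 2 :=
    mul_le_mul_of_nonneg_left (pow_le_pow_left₀ (by linarith) (by linarith) 2) (by linarith)
  have h1' := div_le_div_of_nonneg_right h1 (show (0 : ℝ) ≤ 18 * π by positivity)
  linarith

/-- **The first power sum sandwiched**: `2·∫₀^{T′}tD − k′/4 ≤ p₁ ≤ k′·(T′² + ¼)` (with `HandoffDodgerPowerSums`).
[this track, ATTEMPT-16 §1, Lemma B2; ATTEMPT-19 §8 (P4)] -/
theorem re_dodgerPowerSum_one_bounds {b T₀ : ℝ} {k' : ℕ} (hb : 1 ≤ b)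
    (hKle : π * (zetaZeroCount (π * k' / b)) / b ≤ π * k' / b)
    (hD : Continuous (fun t : ℝ => max 0 (T₀ / (2 * π) * negMulLog (t / T₀) - (0.1038 * Real.log (T₀) + 0.2573 * Real.log (Real.log (T₀)) + 9.3675) - 1) *
      max 0 (min 1 (π * (zetaZeroCount (π * k' / b)) / b - t))))
    (hΔ : ∀ t ∈ Icc 0 (π * k' / b), (zetaZeroCount t : ℝ) - ((min ⌊b * t / π⌋₊ (zetaZeroCount (π * k' / b)) : ℕ) : ℝ) ≤
      -(max 0 (T₀ / (2 * π) * negMulLog (t / T₀) - (0.1038 * Real.log (T₀) + 0.2573 * Real.log (Real.log (T₀)) + 9.3675) - 1) *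
        max 0 (min 1 (π * (zetaZeroCount (π * k' / b)) / b - t)))) :
    2 * (∫ t in (0 : ℝ)..(π * k' / b), t * (max 0 (T₀ / (2 * π) * negMulLog (t / T₀) - (0.1038 * Real.log (T₀) + 0.2573 * Real.log (Real.log (T₀)) + 9.3675) - 1) *
        max 0 (min 1 (π * (zetaZeroCount (π * k' / b)) / b - t)))) - (k' : ℝ) / 4 ≤
      (dodgerPowerSum b (π * k' / b) 1).re ∧
    (dodgerPowerSum b (π * k' / b) 1).re ≤ (k' : ℝ) * ((π * k' / b) ^ 2 + 1 / 4) := by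
  have hπ := Real.pi_pos
  have hb0 : 0 < b := by linarith
  have hT'0 : 0 ≤ π * k' / b := by positivity
  have hKk := zetaZeroCount_horizon_le hb0 hKle
  constructor
  · have h := re_dodgerPowerSum_one_ge_integral hb0 hT'0 hKle hD.continuousOn hΔ
    linarith
  · exact re_dodgerPowerSum_one_le_mul.trans (mul_le_mul_of_nonneg_right hKk (by positivity))

/-- `N(x) ≤ x log x` for `x ≥ 16` (from HSW). [folklore; cite: HasanalizadeShenWong2022, Cor. 1.2 (via the tree)] -/
theorem zetaZeroCount_le_mul_log {x : ℝ} (hx : 16 ≤ x) : (zetaZeroCount x : ℝ) ≤ x * Real.log x := by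
  have hπ3 : 3 < π := Real.pi_gt_three
  have hx0 : 0 < x := by linarith
  have he : Real.exp 1 ≤ x := by have := Real.exp_one_lt_d9; linarith
  have h := (abs_le.1 (zetaZeroCount_hasanalizade_shen_wong_holds x he)).2
  -- `log x ≥ log 16 > 2.7`, `log log x ≤ log x`, `log(x/(2πe)) ≤ log x`
  have hlog16 : (2.7 : ℝ) ≤ Real.log x := by
    have h16 : Real.log 16 = 4 * Real.log 2 := by
      rw [show (16 : ℝ) = 2 ^ 4 by norm_num, Real.log_pow]; norm_num
    have := Real.log_le_log (by norm_num) hx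
    rw [h16] at this
    linarith [Real.log_two_gt_d9]
  have hlx0 : 0 < Real.log x := by linarith
  have hll : Real.log (Real.log x) ≤ Real.log x := by
    have := Real.log_le_sub_one_of_pos hlx0
    linarith
  have hmain : Real.log (x / (2 * π * Real.exp 1)) ≤ Real.log x := by
    apply Real.log_le_log (by positivity)
    rw [div_le_iff₀ (by positivity)]
    have h1 : (1 : ℝ) ≤ 2 * π * Real.exp 1 := by nlinarith [Real.exp_one_gt_d9]
    nlinarith
  have h1 : x / (2 * π) * Real.log (x / (2 * π * Real.exp 1)) ≤ x / (2 * π) * Real.log x :=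
    mul_le_mul_of_nonneg_left hmain (by positivity)
  have h2 : x / (2 * π) ≤ x / 6 := div_le_div_of_nonneg_left hx0.le (by norm_num) (by linarith)
  nlinarith [mul_le_mul_of_nonneg_right h2 hlx0.le]

/-- `(log y + 1)/y ≤ (log x + 1)/x` for `1 ≤ x ≤ y`. [folklore] -/
theorem log_add_one_div_anti {x y : ℝ} (hx : 1 ≤ x) (hxy : x ≤ y) : (Real.log y + 1) / y ≤ (Real.log x + 1) / x := by
  have hx0 : 0 < x := by linarith
  have hy0 : 0 < y := by linarith
  have he := Real.exp_pos 1
  have h : Real.log (Real.exp 1 * y) / (Real.exp 1 * y) ≤ Real.log (Real.exp 1 * x) / (Real.exp 1 * x) :=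
    Real.log_div_self_antitoneOn (a := Real.exp 1 * x) (b := Real.exp 1 * y)
      (by simpa using mul_le_mul_of_nonneg_left hx he.le) (by
        have := mul_le_mul_of_nonneg_left (hx.trans hxy) he.le; simpa using this) (mul_le_mul_of_nonneg_left hxy he.le)
  rw [Real.log_mul he.ne' hy0.ne', Real.log_mul he.ne' hx0.ne', Real.log_exp] at h
  have e1 : (1 + Real.log y) / (Real.exp 1 * y) = (Real.log y + 1) / y / Real.exp 1 := by field_simp; ring
  have e2 : (1 + Real.log x) / (Real.exp 1 * x) = (Real.log x + 1) / x / Real.exp 1 := by field_simp; ring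
  rw [e1, e2] at h
  exact (div_le_div_iff_of_pos_right he).1 h

/-! ## The explicit witness -/

end Summit.RiemannHypothesis.RiemannHypothesis.Theorems.Handoff

end
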